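import Mathlib
import Literature.Computability.AlgebraicComplexity.ValiantClassesProofs
import Summits.ValiantsHypothesis.ValiantsHypothesis.Theses.PermanentalCones

/-!
# Route `PermanentalCones` — item `PermanentalInVP` (stmt-ValiantsHypothesis-8659)

Projection closure for the permanental witness family of the route (card P1): for directions
`r : ℕ → ℕ` and constants `Y n ∈ ℝ^{n×n}`, the complexification of the permanental polynomial
`per[(Y n)_{rows < r n}; s^{(n − r n)}]` — the permanent of the `n × n` matrix whose rows `i < r n`
are the constant rows of `Y n` and whose remaining rows all equal the variable row
`(X 0, …, X (n-1))` — is `aeval a (perPoly (Fin n) ℂ)` for the substitution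
`a (i, j) = C (Y n i j)` if `i < r n` and `a (i, j) = X j` otherwise (`map_permanental_eq_aeval`).
Every `a (i, j)` is a variable or a constant, so this is a Valiant projection, and with `t = id`
a p-projection of the permanent family (`isPProjection_permanental_perPoly`). The family is a
p-family (`n` variables, total degree `≤ n`: `isPFamily_permanental`), hence `per ∈ VP_ℂ`
(`IsVPFamily (perPoly (Fin ·) ℂ)`) puts it in `VP_ℂ` for EVERY choice of `r, Y`, by the tree's
discharged closure of `VP` under p-projections
(`Literature.Computability.AlgebraicComplexity.IsVPFamily.of_isPProjection_holds`;
Bürgisser 2000, §2.1, Rem. 2.7; Valiant 1979). This settles the support item `PermanentalInVP`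
(`permanentalInVP_proof`).
-/

-- `Summit.ValiantsHypothesis.ValiantsHypothesis.…` is the tree's mandated single-conjunct layout
-- (Sub = Summit), so the duplicated namespace component is intended.
set_option linter.dupNamespace false

namespace Summit.ValiantsHypothesis.ValiantsHypothesis.Theorems.PermanentalCones

open MvPolynomial
open Literature.Computability.AlgebraicComplexity
open Summit.ValiantsHypothesis.ValiantsHypothesis.Theses.PermanentalCones

/-- The complexified permanental polynomial is the generic permanent `perPoly (Fin n) ℂ` under the
substitution `(i, j) ↦ C (Y i j)` (rows `i < r`) / `X j` (rows `i ≥ r`): push `map` through the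
permanent's sum of products and compare entrywise. [folklore] -/
theorem map_permanental_eq_aeval (n r : ℕ) (Y : Matrix (Fin n) (Fin n) ℝ) :
    MvPolynomial.map (algebraMap ℝ ℂ)
        (Matrix.of fun i j : Fin n =>
          if (i : ℕ) < r then MvPolynomial.C (Y i j) else MvPolynomial.X j).permanent =
      aeval (fun ij : Fin n × Fin n =>
          if ((ij.1 : Fin n) : ℕ) < r then C (algebraMap ℝ ℂ (Y ij.1 ij.2))
          else (X ij.2 : MvPolynomial (Fin n) ℂ))
        (perPoly (Fin n) ℂ) := by
  simp only [Matrix.permanent, perPoly, Matrix.mvPolynomialX, map_sum, map_prod, Matrix.of_apply,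
    aeval_X]
  refine Finset.sum_congr rfl fun σ _ => Finset.prod_congr rfl fun i _ => ?_
  split_ifs <;> simp

/-- The permanental family is a p-projection (with `t = id`) of the permanent family
`(perPoly (Fin n) ℂ)ₙ`: every substituted entry is a constant or a variable
(Valiant 1979; Bürgisser 2000, Def. 2.6). [folklore] -/
theorem isPProjection_permanental_perPoly (r : ℕ → ℕ) (Y : ∀ n : ℕ, Matrix (Fin n) (Fin n) ℝ) :
    IsPProjection
      (fun n => MvPolynomial.map (algebraMap ℝ ℂ)
        (Matrix.of fun i j : Fin n =>
          if (i : ℕ) < r n then MvPolynomial.C (Y n i j) else MvPolynomial.X j).permanent)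
      (fun n => perPoly (Fin n) ℂ) := by
  refine ⟨_root_.id, IsPBounded.id, fun n => ⟨fun ij : Fin n × Fin n =>
    if ((ij.1 : Fin n) : ℕ) < r n then C (algebraMap ℝ ℂ (Y n ij.1 ij.2))
    else (X ij.2 : MvPolynomial (Fin n) ℂ), fun ij => ?_, map_permanental_eq_aeval n (r n) (Y n)⟩⟩
  by_cases h : ((ij.1 : Fin n) : ℕ) < r n
  · exact Or.inr ⟨algebraMap ℝ ℂ (Y n ij.1 ij.2), by simp [h]⟩
  · exact Or.inl ⟨ij.2, by simp [h]⟩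

/-- The complexified permanental polynomial has total degree at most `n`: it is a sum of products
of `n` entries, each a constant or a variable (total degree `≤ 1`). [folklore] -/
theorem totalDegree_map_permanental_le (n r : ℕ) (Y : Matrix (Fin n) (Fin n) ℝ) :
    (MvPolynomial.map (algebraMap ℝ ℂ)
        (Matrix.of fun i j : Fin n =>
          if (i : ℕ) < r then MvPolynomial.C (Y i j) else MvPolynomial.X j).permanent).totalDegree
      ≤ n := by
  simp only [Matrix.permanent, map_sum, map_prod, Matrix.of_apply]
  refine totalDegree_finsetSum_le fun σ _ => (totalDegree_finsetProd _ _).trans ?_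
  calc ∑ i : Fin n, (MvPolynomial.map (algebraMap ℝ ℂ)
          (if ((σ i : Fin n) : ℕ) < r then MvPolynomial.C (Y (σ i) i) else MvPolynomial.X i)).totalDegree
        ≤ ∑ _i : Fin n, 1 := Finset.sum_le_sum fun i _ => by split_ifs <;> simp
    _ = n := by simp

/-- The permanental family is a p-family: `n` variables and total degree `≤ n`
(Bürgisser 2000, Def. 2.3). [folklore] -/
theorem isPFamily_permanental (r : ℕ → ℕ) (Y : ∀ n : ℕ, Matrix (Fin n) (Fin n) ℝ) :
    IsPFamily
      (fun n => MvPolynomial.map (algebraMap ℝ ℂ)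
        (Matrix.of fun i j : Fin n =>
          if (i : ℕ) < r n then MvPolynomial.C (Y n i j) else MvPolynomial.X j).permanent) := by
  refine ⟨⟨1, fun n => by simp⟩, ⟨1, fun n => ?_⟩⟩
  exact (totalDegree_map_permanental_le n (r n) (Y n)).trans (by simp)

/-- **Settles item `PermanentalInVP` (stmt-ValiantsHypothesis-8659)**: if the permanent family
`(perPoly (Fin n) ℂ)ₙ` is a `VP_ℂ` family, then so is the complexified permanental family
`per[(Y n)_{rows < r n}; s^{(n − r n)}]` for every `r : ℕ → ℕ` and every `Y`, since it is a
p-family and a p-projection of the permanent family, and `VP` is closed under p-projections among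
p-families (`IsVPFamily.of_isPProjection_holds`; Bürgisser 2000, §2.1; Valiant 1979). [folklore] -/
theorem permanentalInVP_proof : PermanentalInVP := by
  intro hper r Y
  exact IsVPFamily.of_isPProjection_holds (isPFamily_permanental r Y)
    (isPProjection_permanental_perPoly r Y) hper

end Summit.ValiantsHypothesis.ValiantsHypothesis.Theorems.PermanentalCones
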